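import Mathlib.MeasureTheory.Integral.Pi
import Literature.MathematicalPhysics.KineticTheory.HardSphereEulerProofs
import Literature.MathematicalPhysics.KineticTheory.InfiniteChainSeveredGibbs
import HarnessLib

/-!
# The finite-volume Gibbs kernels of the chain in transfer-operator form

Topic `Literature/MathematicalPhysics/KineticTheory`; proofs-only companion of
`InfiniteChainDynamics.lean` (`chainSpecification T Λ η`, the `Measure.tilted` of
`(dq dp)^{⊗Λ} ⊗ δ_η` by `-H_Λ/T`, LLL (14)) and `InfiniteChainSeveredGibbs.lean` (`hamiltonianIn_chain`,
`bondSet`). It rewrites every finite-volume Gibbs distribution of a nearest-neighbour chain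
`P : OscillatorChain` in the form used by transfer-operator arguments (Georgii 2011, (2.18)–(2.19):
a `ρ`-specification with a FINITE one-particle a priori measure and bond Boltzmann factors):

* `exp_neg_hamiltonianIn_div` — `e^{-H_Λ/T} = ∏_{x∈Λ} e^{-(p_x²/2+U(q_x))/T} · ∏_{y∈bondSet Λ} e^{-V(q_{y+1}-q_y)/T}`;
* `integral_chainSpecification_eq_div` (**main**) — for measurable `F`,
  `∫ F dγ_Λ(·|η) = (∫ F(ζη) B_Λ(ζη) dρ_T^{⊗Λ}(ζ)) / (∫ B_Λ(ζη) dρ_T^{⊗Λ}(ζ))` with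
  `ρ_T(dq dp) = e^{-(p²/2+U(q))/T} dq dp` (a `withDensity` of Lebesgue measure on `ℝ × ℝ`) and
  `B_Λ(σ) = ∏_{y∈bondSet Λ} e^{-V(q_{y+1}-q_y)/T}`; unconditional in `T` (same junk on both sides);
  `real_chainSpecification_eq_div` — the same for `γ_Λ(A | η)`;
* `isFiniteMeasure_siteMeasure` — `ρ_T` is finite when its density is integrable;
  `bondKernel_symm_bound_pos` — the transfer kernel `e^{-V(q'-q)/T}` is symmetric (`V` even),
  bounded by `1` (`V ≥ 0`, `T ≥ 0`) and strictly positive;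
(The product-of-`withDensity` lemma is the tree's
`Literature.MathematicalPhysics.KineticTheory.pi_withDensity_eq`, `HardSphereEulerProofs.lean`.)

Everything is proved; no definitions (the measure `ρ_T` and the kernel are written out). Consumers:
existence and uniqueness of the shift-invariant DLR state of the pinned anharmonic chain via the
compact positivity-improving transfer operator on `L²(ρ_T)`
(`Literature.Analysis.OperatorTheory.exists_transferOperator`, `IsPositivityImproving.exists_spectralGap`).
[cite: LanfordLebowitzLieb1977, §4 eq. (14)]
-/

noncomputable section

open MeasureTheory Filter Topology Set Real Literature.Probability.LatticeModels
open scoped ENNReal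

namespace Literature.MathematicalPhysics.KineticTheory.HeatConduction

namespace OscillatorChain

variable (P : OscillatorChain)

/-! ### Factorisation of the Boltzmann weight -/

/-- **Factorisation of the Boltzmann weight of a finite volume**:
`e^{-H_Λ(σ)/T} = ∏_{x∈Λ} e^{-(p_x²/2+U(q_x))/T} · ∏_{y ∈ bondSet Λ} e^{-V(q_{y+1}-q_y)/T}` — the
one-particle weights of the sites of `Λ` times the bond Boltzmann factors of the bonds meeting `Λ`
(LLL (10)/(14)). [cite: LanfordLebowitzLieb1977, §4 eq. (14)] -/
theorem exp_neg_hamiltonianIn_div (T : ℝ) (Λ : Finset ℤ) (σ : ChainConfig) :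
    exp (-T⁻¹ * hamiltonianIn P.chainPotential chainSupp Λ σ) =
      (∏ x ∈ Λ, exp (-((σ x).2 ^ 2 / 2 + P.U (σ x).1) / T)) *
        ∏ y ∈ bondSet Λ, exp (-P.V ((σ (y + 1)).1 - (σ y).1) / T) := by
  rw [hamiltonianIn_chain, mul_add, Real.exp_add, Finset.mul_sum, Finset.mul_sum, Real.exp_sum,
    Real.exp_sum]
  congr 1
  · refine Finset.prod_congr rfl fun x _ => ?_
    congr 1
    ring
  · refine Finset.prod_congr rfl fun y _ => ?_
    congr 1
    ring

/-- Inside `Λ` the one-particle weights of the glued configuration are those of `ζ`: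
`∏_{x∈Λ} w((ζη)_x) = ∏_{i : Λ} w(ζ_i)`. [folklore] -/
theorem prod_siteWeight_glueWith (T : ℝ) (Λ : Finset ℤ) (ζ : Λ → ℝ × ℝ) (η : ChainConfig) :
    ∏ x ∈ Λ, exp (-(((glueWith Λ ζ η) x).2 ^ 2 / 2 + P.U ((glueWith Λ ζ η) x).1) / T) =
      ∏ i : Λ, exp (-((ζ i).2 ^ 2 / 2 + P.U (ζ i).1) / T) := by
  rw [← Finset.prod_coe_sort]
  refine Finset.prod_congr rfl fun i _ => ?_
  rw [glueWith_apply_mem Λ ζ η i.2]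

/-! ### The kernels as normalised bond-weighted product measures -/

/-- Measurability of the bond Boltzmann factor `∏_{y ∈ bondSet Λ} e^{-V(q_{y+1}-q_y)/T}` for
continuous `V`. [folklore] -/
theorem measurable_bondWeight (hV : Continuous P.V) (T : ℝ) (Λ : Finset ℤ) :
    Measurable fun σ : ChainConfig => ∏ y ∈ bondSet Λ, exp (-P.V ((σ (y + 1)).1 - (σ y).1) / T) := by
  refine Finset.measurable_prod _ fun y _ => ?_
  have h1 : Measurable fun σ : ChainConfig => (σ (y + 1)).1 := (measurable_pi_apply _).fst
  have h2 : Measurable fun σ : ChainConfig => (σ y).1 := (measurable_pi_apply _).fst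
  exact measurable_exp.comp ((hV.measurable.comp (h1.sub h2)).neg.div_const T)

/-- Measurability of the one-particle weight `e^{-(p²/2+U(q))/T}` for continuous `U`. [folklore] -/
theorem measurable_siteWeight (hU : Continuous P.U) (T : ℝ) :
    Measurable fun z : ℝ × ℝ => exp (-(z.2 ^ 2 / 2 + P.U z.1) / T) := by
  have : Continuous fun z : ℝ × ℝ => exp (-(z.2 ^ 2 / 2 + P.U z.1) / T) := by fun_prop
  exact this.measurable

/-- **The finite-volume Gibbs distribution in transfer-operator form (integrals).** For every finite
`Λ`, boundary condition `η` and measurable `F`, the expectation of `F` under `γ_Λ(· | η)` (LLL (14),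
`chainSpecification`) is the NORMALISED integral of `F · ∏_{bonds meeting Λ} e^{-V/T}` against the
product over `Λ` of the FINITE one-particle a priori measures `ρ_T(dq dp) = e^{-(p²/2+U(q))/T} dq dp`,
glued to `η` outside `Λ`:
`∫ F dγ_Λ(·|η) = (∫ F(ζη) B_Λ(ζη) ρ_T^{⊗Λ}(dζ)) / (∫ B_Λ(ζη) ρ_T^{⊗Λ}(dζ))`,
`B_Λ(σ) = ∏_{y ∈ bondSet Λ} e^{-V(q_{y+1}-q_y)/T}` (Georgii's "`ρ`-specification" form of a Gibbsian
specification, Georgii 2011 (2.18)/(2.19); unconditional: both sides carry the same junk `0` when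
the normaliser vanishes or diverges). [cite: LanfordLebowitzLieb1977, §4 eq. (14)] -/
theorem integral_chainSpecification_eq_div (hU : Continuous P.U) (hV : Continuous P.V) (T : ℝ)
    (Λ : Finset ℤ) (η : ChainConfig) {F : ChainConfig → ℝ} (hF : Measurable F) :
    ∫ σ, F σ ∂(P.chainSpecification T Λ η) =
      (∫ ζ, F (glueWith Λ ζ η) *
          ∏ y ∈ bondSet Λ, exp (-P.V (((glueWith Λ ζ η) (y + 1)).1 - ((glueWith Λ ζ η) y).1) / T)
        ∂(Measure.pi fun _ : Λ => (volume : Measure (ℝ × ℝ)).withDensity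
          fun z => ENNReal.ofReal (exp (-(z.2 ^ 2 / 2 + P.U z.1) / T)))) /
      (∫ ζ, ∏ y ∈ bondSet Λ, exp (-P.V (((glueWith Λ ζ η) (y + 1)).1 - ((glueWith Λ ζ η) y).1) / T)
        ∂(Measure.pi fun _ : Λ => (volume : Measure (ℝ × ℝ)).withDensity
          fun z => ENNReal.ofReal (exp (-(z.2 ^ 2 / 2 + P.U z.1) / T)))) := by
  -- notation
  set pi : Measure (Λ → ℝ × ℝ) := Measure.pi fun _ : Λ => (volume : Measure (ℝ × ℝ)) with hpi
  set w : ℝ × ℝ → ℝ := fun z => exp (-(z.2 ^ 2 / 2 + P.U z.1) / T) with hw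
  set B : ChainConfig → ℝ := fun σ => ∏ y ∈ bondSet Λ, exp (-P.V ((σ (y + 1)).1 - (σ y).1) / T)
    with hB
  set f : ChainConfig → ℝ := fun σ => -T⁻¹ * hamiltonianIn P.chainPotential chainSupp Λ σ with hf
  have hwm : Measurable w := P.measurable_siteWeight hU T
  have hBm : Measurable B := P.measurable_bondWeight hV T Λ
  have hfm : Measurable fun σ => exp (f σ) :=
    measurable_exp.comp (measurable_const.mul (P.continuous_hamiltonianIn_chain hU hV Λ).measurable)
  have hglue : Measurable fun ζ : Λ → ℝ × ℝ => glueWith Λ ζ η := measurable_glueWith Λ η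
  -- the product of the weighted one-particle measures
  have hpiw : (Measure.pi fun _ : Λ => (volume : Measure (ℝ × ℝ)).withDensity
      fun z => ENNReal.ofReal (w z)) = pi.withDensity fun ζ => ∏ i, ENNReal.ofReal (w (ζ i)) := by
    rw [hpi]
    exact Literature.MathematicalPhysics.KineticTheory.pi_withDensity_eq
        (fun _ => (volume : Measure (ℝ × ℝ)))
      (fun _ => hwm.ennreal_ofReal) (fun _ => inferInstance)
  -- factorisation of `e^f` along the glued configuration
  have hfact : ∀ ζ : Λ → ℝ × ℝ, exp (f (glueWith Λ ζ η)) =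
      (∏ i, w (ζ i)) * B (glueWith Λ ζ η) := by
    intro ζ
    rw [hf]
    dsimp only
    rw [P.exp_neg_hamiltonianIn_div T Λ, P.prod_siteWeight_glueWith T Λ ζ η]
  -- integrals against `pi.withDensity (∏ w)` are integrals of `(∏ w) • ·` against `pi`
  have hdens : ∀ G : (Λ → ℝ × ℝ) → ℝ,
      ∫ ζ, G ζ ∂(pi.withDensity fun ζ => ∏ i, ENNReal.ofReal (w (ζ i))) =
        ∫ ζ, (∏ i, w (ζ i)) * G ζ ∂pi := by
    intro G
    rw [integral_withDensity_eq_integral_toReal_smul]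
    · refine integral_congr_ae (Eventually.of_forall fun ζ => ?_)
      dsimp only
      rw [ENNReal.toReal_prod, smul_eq_mul]
      congr 1
      refine Finset.prod_congr rfl fun i _ => ?_
      exact ENNReal.toReal_ofReal (exp_pos _).le
    · exact Finset.measurable_prod _ fun i _ => (hwm.comp (measurable_pi_apply i)).ennreal_ofReal
    · exact Eventually.of_forall fun ζ => ENNReal.prod_lt_top fun i _ => ENNReal.ofReal_lt_top
  -- unfold the tilted kernel
  change ∫ σ, F σ ∂((pi.map fun ζ => glueWith Λ ζ η).tilted f) = _
  rw [integral_tilted, hpiw, hdens, hdens]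
  -- the normaliser
  have hZ : ∫ σ, exp (f σ) ∂(pi.map fun ζ => glueWith Λ ζ η) =
      ∫ ζ, (∏ i, w (ζ i)) * B (glueWith Λ ζ η) ∂pi := by
    rw [integral_map hglue.aemeasurable hfm.aestronglyMeasurable]
    exact integral_congr_ae (Eventually.of_forall fun ζ => hfact ζ)
  rw [hZ, integral_map hglue.aemeasurable]
  · simp_rw [hfact]
    rw [← integral_div]
    refine integral_congr_ae (Eventually.of_forall fun ζ => ?_)
    simp only [smul_eq_mul]
    ring
  · exact ((hfm.div_const _).smul hF).aestronglyMeasurable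

/-- **The finite-volume Gibbs distribution in transfer-operator form (probabilities).** For a
measurable set `A`, `γ_Λ(A | η)` (as a real number) is the normalised `ρ_T^{⊗Λ}`-integral of the
bond Boltzmann factor over the glued configurations lying in `A`. [cite: LanfordLebowitzLieb1977, §4 eq. (14)] -/
theorem real_chainSpecification_eq_div (hU : Continuous P.U) (hV : Continuous P.V) (T : ℝ)
    (Λ : Finset ℤ) (η : ChainConfig) {A : Set ChainConfig} (hA : MeasurableSet A) :
    (P.chainSpecification T Λ η).real A =
      (∫ ζ, A.indicator (1 : ChainConfig → ℝ) (glueWith Λ ζ η) *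
          ∏ y ∈ bondSet Λ, exp (-P.V (((glueWith Λ ζ η) (y + 1)).1 - ((glueWith Λ ζ η) y).1) / T)
        ∂(Measure.pi fun _ : Λ => (volume : Measure (ℝ × ℝ)).withDensity
          fun z => ENNReal.ofReal (exp (-(z.2 ^ 2 / 2 + P.U z.1) / T)))) /
      (∫ ζ, ∏ y ∈ bondSet Λ, exp (-P.V (((glueWith Λ ζ η) (y + 1)).1 - ((glueWith Λ ζ η) y).1) / T)
        ∂(Measure.pi fun _ : Λ => (volume : Measure (ℝ × ℝ)).withDensity
          fun z => ENNReal.ofReal (exp (-(z.2 ^ 2 / 2 + P.U z.1) / T)))) := by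
  rw [← P.integral_chainSpecification_eq_div hU hV T Λ η (measurable_one.indicator hA),
    integral_indicator_one hA]

/-- The one-particle a priori measure `ρ_T(dq dp) = e^{-(p²/2+U(q))/T} dq dp` is FINITE as soon as
its density is Lebesgue integrable (e.g. `T > 0` and `e^{-U/T} ∈ L¹`, see
`InfiniteChainGibbsNormalisable`). [folklore] -/
theorem isFiniteMeasure_siteMeasure (T : ℝ)
    (hw : Integrable (fun z : ℝ × ℝ => exp (-(z.2 ^ 2 / 2 + P.U z.1) / T))) :
    IsFiniteMeasure ((volume : Measure (ℝ × ℝ)).withDensity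
      fun z => ENNReal.ofReal (exp (-(z.2 ^ 2 / 2 + P.U z.1) / T))) :=
  isFiniteMeasure_withDensity_ofReal hw.2

/-- The bond Boltzmann factor of the chain is SYMMETRIC when `V` is even, BOUNDED by `1` when `V ≥ 0`
and always STRICTLY POSITIVE — the three structural properties of the transfer kernel
`k(z, z') = e^{-V(q'-q)/T}` used by the Perron–Frobenius–Jentzsch theory
(`Literature.Analysis.OperatorTheory.exists_transferOperator`). [folklore] -/
theorem bondKernel_symm_bound_pos (T : ℝ) (hVsymm : ∀ r, P.V (-r) = P.V r) (hV0 : ∀ r, 0 ≤ P.V r)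
    (hT : 0 ≤ T) :
    (∀ z z' : ℝ × ℝ, exp (-P.V (z'.1 - z.1) / T) = exp (-P.V (z.1 - z'.1) / T)) ∧
      (∀ z z' : ℝ × ℝ, ‖exp (-P.V (z'.1 - z.1) / T)‖ ≤ 1) ∧
      ∀ z z' : ℝ × ℝ, 0 < exp (-P.V (z'.1 - z.1) / T) := by
  refine ⟨fun z z' => ?_, fun z z' => ?_, fun z z' => exp_pos _⟩
  · rw [← hVsymm (z'.1 - z.1), neg_sub]
  · rw [Real.norm_eq_abs, abs_of_pos (exp_pos _), exp_le_one_iff, neg_div]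
    exact neg_nonpos.2 (div_nonneg (hV0 _) hT)


end OscillatorChain

end Literature.MathematicalPhysics.KineticTheory.HeatConduction

end
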